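import Summits.BirchSwinnertonDyer.Rank1Residual.X11b.Three.UnramifiedMinimalBaseChange
import HarnessLib

/-!
# X11b at `p = 3` (team N8/O2), JET3-KUMMER: additive Hilbert 90 for the complete unramified
# layer and Galois descent modulo `𝔪ʲ` (S15 (viii), part 17 — the descent engine for the
# minimality of the `K_v`-minimal equation over the layer in EVERY residue characteristic)

HONEST FRAMING (cell `b2b-bsdres`, run/shared/lean/b2b/bsd-rank1-residual/, verbatim in every
file): the goal of the cell is to DELETE the COMBINATION-SHAPED residual classes of the
Birch–Swinnerton-Dyer formula for ALL analytic-rank `≤ 1` elliptic curves over `ℚ` — "full BSD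
formula for every rank `≤ 1` curve in class `C`" assembled STRICTLY from published theorems — so
that the rank-`≤ 1` remainder becomes exactly the CONSTRUCTION-SHAPED classes, which are TYPED
(missing-input `Prop`s), NOT attempted. This is not "finishing BSD". Team N8/O2 = `x11b3`, seat
`b2b-bsdres-x11b3-p4` (provider of record at additive places), S15 (viii) part 17. THEOREMS ONLY:
no definition, no named fact, no `sorry`; nothing is booked; `JET@p|N` is NOT discharged.

## What

The S15 layer (`S15-INTERFACE.md` §1/§4): `R` a complete discrete valuation ring of `L` with finite
residue field `k` of order `qⁿ`, an automorphism `e` of `R` (the restriction of the Frobenius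
generator `φ ∈ Aut(L/F)`) inducing `x ↦ x^q` on `k`, with `eⁿ = 1` and fixing a uniformiser `ϖ`
(the layer is unramified: `ϖ` comes from `F`). Pure commutative algebra:

* §1 `sum_range_pow_apply_sub` (telescoping `Σ_{i<n} eⁱ(e b − b) = eⁿ b − b`),
  **`exists_apply_sub_eq_of_sum_pow_eq_zero`** — ADDITIVE HILBERT 90 FOR THE LAYER in cyclic
  form: `Σ_{i<n} eⁱ y = 0 ⇒ y = e b − b` for some `b ∈ R` (`H¹(⟨e⟩, R) = 0`). Proof: the residue
  statement is part 7 (`exists_frob_sub_eq_of_sum_pow_eq_zero`, finite field of `qⁿ` elements);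
  one correction step divides the defect by `ϖ`; the corrections converge by completeness
  (Mathlib `IsPrecomplete`) and the limit solves the equation exactly (`IsHausdorff`). Serre,
  *Local Fields* X §1 Prop. 1 / V §2 (normal basis: `H¹(Gal, 𝒪_L) = 0` for unramified `L/K`).
* §2 **`exists_sub_algebraMap_mem_pow_of_apply_sub_mem_pow`** — GALOIS DESCENT MODULO `𝔪ʲ`: if
  `e x − x ∈ 𝔪ʲ` then `x ∈ ι R₀ + 𝔪ʲ`, provided the fixed points of `e` in `R` come from `R₀`
  (write `e x − x = ϖʲ y`; `Σ eⁱ y = 0` by telescoping; `y = e b − b` by §1; `x − ϖʲ b` is fixed).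
* §3 the S15 instantiation: **`exists_ringEquiv_frobenius`** (the restriction `e` of `φ` to `R`
  exists and has the four properties — from R1 `hR`, R4 `hφ`/`hn`/`hfrob`, R5 `hπ`, R6
  `[IsGalois F L]`, `R ∩ F = R₀` of part 1) and the export
  **`exists_ringEquiv_frobenius_descent`** (`∃ e`, `ι ∘ e = φ ∘ ι`, `e` fixes `ι R₀`, and the
  descent property of §2 for every `j`).

Consumed by part 18 (`UnramifiedMinimalDescent`): the classes `s mod 𝔪`, `r mod 𝔪²`, `t mod 𝔪³`
of a non-minimality witness `(r, s, t)` over the layer descend to `R₀`.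

References (locators only; no new fact): [cite: SerreLocalFields1979, X §1 Prop. 1, V §2, VII §1]
[cite: SilvermanAEC2009, Prop. VII.5.4 (a) (PDF p. 175)].

## Design

No definitions; `noncomputable section`; `open scoped Classical`; universe `u` for `F`, `L`.
Axioms: `propext`, `Classical.choice`, `Quot.sound`.
-/

noncomputable section

open scoped Classical

namespace Summit.BirchSwinnertonDyer.Rank1Residual.X11b.Three.JetchevKummer

open IsDiscreteValuationRing

universe u

/-! ### §1 Additive Hilbert 90 for the complete layer, cyclic form -/

section Ring

variable (R : Type*) [CommRing R] [IsDomain R] [IsDiscreteValuationRing R]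

omit [IsDomain R] [IsDiscreteValuationRing R] in
/-- Telescoping: `Σ_{i<n} eⁱ (e b − b) = eⁿ b − b`. [folklore] -/
theorem sum_range_pow_apply_sub (e : R ≃+* R) (b : R) (n : ℕ) :
    ∑ i ∈ Finset.range n, (e ^ i) (e b - b) = (e ^ n) b - b := by
  induction n with
  | zero => simp
  | succ n ih =>
    rw [Finset.sum_range_succ, ih, map_sub, pow_succ, RingAut.mul_apply]
    ring

omit [IsDomain R] [IsDiscreteValuationRing R] in
/-- `eⁱ` commutes with multiplication by an `e`-fixed element. [folklore] -/
theorem pow_apply_mul_of_apply_eq (e : R ≃+* R) {c : R} (hc : e c = c) (i : ℕ) (y : R) :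
    (e ^ i) (c * y) = c * (e ^ i) y := by
  induction i generalizing y with
  | zero => simp
  | succ i ih => rw [pow_succ, RingAut.mul_apply, RingAut.mul_apply, map_mul, hc, ih]

omit [IsDomain R] [IsDiscreteValuationRing R] in
/-- `Σ_{i<n} eⁱ (c y) = c Σ_{i<n} eⁱ y` for an `e`-fixed `c`. [folklore] -/
theorem sum_range_pow_apply_mul_of_apply_eq (e : R ≃+* R) {c : R} (hc : e c = c) (n : ℕ) (y : R) :
    ∑ i ∈ Finset.range n, (e ^ i) (c * y) = c * ∑ i ∈ Finset.range n, (e ^ i) y := by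
  rw [Finset.mul_sum]
  exact Finset.sum_congr rfl fun i _ ↦ pow_apply_mul_of_apply_eq R e hc i y

/-- **One correction step.** With `k` finite of order `qⁿ` and `e` inducing `x ↦ x^q` on `k`: if
`Σ_{i<n} eⁱ z = 0` then `z ≡ e c − c (mod 𝔪)` for some `c ∈ R` — the residue of `z` has trace
zero, part 7 `exists_frob_sub_eq_of_sum_pow_eq_zero`. [cite: SerreLocalFields1979, X §1 Prop. 1] -/
theorem exists_sub_apply_sub_mem_maximalIdeal [Finite (IsLocalRing.ResidueField R)] (e : R ≃+* R)
    {q n : ℕ} (hcard : Nat.card (IsLocalRing.ResidueField R) = q ^ n)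
    (hfrob : ∀ a : R, IsLocalRing.residue R (e a) = IsLocalRing.residue R a ^ q) (z : R)
    (hz : ∑ i ∈ Finset.range n, (e ^ i) z = 0) :
    ∃ c : R, z - (e c - c) ∈ IsLocalRing.maximalIdeal R := by
  haveI : IsLocalHom (e : R →+* R) := ⟨fun a ha ↦ (isLocalHom_equiv e).map_nonunit a ha⟩
  set σk : IsLocalRing.ResidueField R →+* IsLocalRing.ResidueField R :=
    IsLocalRing.ResidueField.map (e : R →+* R) with hσkdef
  have hσk' : ∀ c : R, σk (IsLocalRing.residue R c) = IsLocalRing.residue R (e c) := fun c ↦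
    IsLocalRing.ResidueField.map_residue (e : R →+* R) c
  have hσk : ∀ x : IsLocalRing.ResidueField R, σk x = x ^ q := by
    intro x
    obtain ⟨c, rfl⟩ := IsLocalRing.residue_surjective x
    rw [hσk', hfrob]
  have hiter : ∀ (i : ℕ) (c : R), IsLocalRing.residue R ((e ^ i) c) =
      (⇑σk)^[i] (IsLocalRing.residue R c) := by
    intro i
    induction i with
    | zero => intro c; simp
    | succ i ih =>
      intro c
      rw [pow_succ, RingAut.mul_apply, Function.iterate_succ_apply, hσk', ih]
  have hres : ∑ i ∈ Finset.range n, (⇑σk)^[i] (IsLocalRing.residue R z) = 0 := by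
    have := congrArg (IsLocalRing.residue R) hz
    rw [map_sum, map_zero] at this
    simpa only [hiter] using this
  obtain ⟨cbar, hc⟩ := exists_frob_sub_eq_of_sum_pow_eq_zero σk hcard hσk _ hres
  obtain ⟨c, rfl⟩ := IsLocalRing.residue_surjective cbar
  refine ⟨c, ?_⟩
  rw [← IsLocalRing.residue_eq_zero_iff, map_sub, map_sub, ← hσk', hc, sub_self]

/-- **Additive Hilbert 90 for the complete unramified layer, cyclic form: `H¹(⟨e⟩, R) = 0`.** Let
`R` be a complete discrete valuation ring with finite residue field of order `qⁿ`, `e` a ring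
automorphism of `R` inducing `x ↦ x^q` on the residue field, with `eⁿ = 1` and `e ϖ = ϖ` for a
uniformiser `ϖ` (unramified layer). Then every `y ∈ R` with `Σ_{i<n} eⁱ y = 0` is `e b − b` for
some `b ∈ R`. Proof: successive approximation — each step (`exists_sub_apply_sub_mem_maximalIdeal`)
improves a solution modulo `𝔪ᴺ` to one modulo `𝔪ᴺ⁺¹` by a correction in `𝔪ᴺ` (the defect divided
by `ϖᴺ` again has trace zero); the corrections converge (`IsPrecomplete`) and the limit is an exact
solution (`IsHausdorff`). Serre, *Local Fields* X §1 Prop. 1 with V §2.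
[cite: SerreLocalFields1979, X §1 Prop. 1, V §2] -/
theorem exists_apply_sub_eq_of_sum_pow_eq_zero [IsAdicComplete (IsLocalRing.maximalIdeal R) R]
    [Finite (IsLocalRing.ResidueField R)] (e : R ≃+* R) {q n : ℕ}
    (hcard : Nat.card (IsLocalRing.ResidueField R) = q ^ n)
    (hfrob : ∀ a : R, IsLocalRing.residue R (e a) = IsLocalRing.residue R a ^ q)
    (hn : ∀ a : R, (e ^ n) a = a) {ϖ : R} (hϖ : Irreducible ϖ) (hϖe : e ϖ = ϖ) (y : R)
    (hy : ∑ i ∈ Finset.range n, (e ^ i) y = 0) : ∃ b : R, e b - b = y := by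
  have hϖ0 : ϖ ≠ 0 := hϖ.ne_zero
  have hpowfix : ∀ N : ℕ, e (ϖ ^ N) = ϖ ^ N := fun N ↦ by rw [map_pow, hϖe]
  -- one step: from a solution modulo `ϖᴺ` to one modulo `ϖᴺ⁺¹`, correction divisible by `ϖᴺ`
  have step : ∀ (N : ℕ) (b : R), ϖ ^ N ∣ y - (e b - b) →
      ∃ b' : R, ϖ ^ N ∣ b' - b ∧ ϖ ^ (N + 1) ∣ y - (e b' - b') := by
    intro N b hb
    obtain ⟨z, hz⟩ := hb
    -- `Σ eⁱ z = 0`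
    have hsum : ∑ i ∈ Finset.range n, (e ^ i) z = 0 := by
      have h1 : ∑ i ∈ Finset.range n, (e ^ i) (y - (e b - b)) = 0 := by
        rw [Finset.sum_congr rfl fun i _ ↦ map_sub (e ^ i) y (e b - b), Finset.sum_sub_distrib, hy,
          sum_range_pow_apply_sub R e b n, hn b, sub_self, sub_zero]
      rw [hz, sum_range_pow_apply_mul_of_apply_eq R e (hpowfix N) n z] at h1
      exact (mul_eq_zero.mp h1).resolve_left (pow_ne_zero N hϖ0)
    obtain ⟨c, hc⟩ := exists_sub_apply_sub_mem_maximalIdeal R e hcard hfrob z hsum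
    rw [hϖ.maximalIdeal_eq, Ideal.mem_span_singleton] at hc
    obtain ⟨z', hz'⟩ := hc
    refine ⟨b + ϖ ^ N * c, ⟨c, by ring⟩, ⟨z', ?_⟩⟩
    rw [map_add, map_mul, hpowfix N,
      show y - (e b + ϖ ^ N * e c - (b + ϖ ^ N * c)) = (y - (e b - b)) - ϖ ^ N * (e c - c) by ring,
      hz, ← mul_sub, hz', pow_succ]
    ring
  -- the sequence of approximations
  let s : (N : ℕ) → {b : R // ϖ ^ N ∣ y - (e b - b)} :=
    Nat.rec ⟨0, by simp⟩ fun N bN ↦ ⟨(step N bN.1 bN.2).choose, (step N bN.1 bN.2).choose_spec.2⟩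
  have hs_succ : ∀ N, ϖ ^ N ∣ (s (N + 1)).1 - (s N).1 := fun N ↦
    (step N (s N).1 (s N).2).choose_spec.1
  have hmod : ∀ {m N}, m ≤ N → ϖ ^ m ∣ (s N).1 - (s m).1 := by
    intro m N hmN
    induction N, hmN using Nat.le_induction with
    | base => simp
    | succ N hmN ih =>
      have h1 : ϖ ^ m ∣ (s (N + 1)).1 - (s N).1 := (pow_dvd_pow ϖ hmN).trans (hs_succ N)
      have := dvd_add h1 ih
      rwa [show (s (N + 1)).1 - (s N).1 + ((s N).1 - (s m).1) = (s (N + 1)).1 - (s m).1 by ring]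
        at this
  have hpow : ∀ k, IsLocalRing.maximalIdeal R ^ k = Ideal.span {ϖ ^ k} := fun k ↦ by
    rw [hϖ.maximalIdeal_eq, Ideal.span_singleton_pow]
  have hcauchy : ∀ {m N}, m ≤ N →
      (s m).1 ≡ (s N).1 [SMOD (IsLocalRing.maximalIdeal R ^ m • (⊤ : Submodule R R))] := by
    intro m N hmN
    rw [SModEq.sub_mem, smul_eq_mul, Ideal.mul_top, hpow, Ideal.mem_span_singleton]
    have := hmod hmN
    rwa [← dvd_neg, neg_sub] at this
  obtain ⟨b, hb⟩ := IsPrecomplete.prec' (fun N ↦ (s N).1) hcauchy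
  refine ⟨b, ?_⟩
  -- the limit is an exact solution: the defect lies in every power of `𝔪`
  have key : y - (e b - b) = 0 := by
    refine IsHausdorff.haus' (I := IsLocalRing.maximalIdeal R) (y - (e b - b)) fun N ↦ ?_
    rw [SModEq.sub_mem, sub_zero, smul_eq_mul, Ideal.mul_top, hpow, Ideal.mem_span_singleton]
    have h1 : ϖ ^ N ∣ (s N).1 - b := by
      have := hb N
      rwa [SModEq.sub_mem, smul_eq_mul, Ideal.mul_top, hpow, Ideal.mem_span_singleton] at this
    have h2 : ϖ ^ N ∣ e ((s N).1 - b) - ((s N).1 - b) := by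
      obtain ⟨d, hd⟩ := h1
      rw [hd, map_mul, hpowfix N, ← mul_sub]
      exact Dvd.intro _ rfl
    have := dvd_add (s N).2 h2
    rwa [map_sub, show y - (e (s N).1 - (s N).1) + (e (s N).1 - e b - ((s N).1 - b)) =
      y - (e b - b) by ring] at this
  exact (sub_eq_zero.mp key).symm

/-! ### §2 Galois descent modulo `𝔪ʲ` -/

/-- **Galois descent modulo `𝔪ʲ` along the unramified layer.** Same `R`, `e`, `ϖ` as in
`exists_apply_sub_eq_of_sum_pow_eq_zero`, and suppose the fixed points of `e` in `R` come from `R₀`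
(`hfix`). If `e x − x ∈ 𝔪ʲ` then `x − ι x₀ ∈ 𝔪ʲ` for some `x₀ ∈ R₀`: writing `e x − x = ϖʲ y`,
telescoping gives `Σ eⁱ y = 0`, so `y = e b − b` (§1) and `x − ϖʲ b` is `e`-fixed.
(`(R/𝔪ʲ)^{⟨e⟩} = R₀/𝔪₀ʲ`, from `H¹(⟨e⟩, 𝔪ʲ) = 0`.) [cite: SerreLocalFields1979, X §1 Prop. 1, VII §1] -/
theorem exists_sub_algebraMap_mem_pow_of_apply_sub_mem_pow
    [IsAdicComplete (IsLocalRing.maximalIdeal R) R] [Finite (IsLocalRing.ResidueField R)]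
    (e : R ≃+* R) {q n : ℕ} (hcard : Nat.card (IsLocalRing.ResidueField R) = q ^ n)
    (hfrob : ∀ a : R, IsLocalRing.residue R (e a) = IsLocalRing.residue R a ^ q)
    (hn : ∀ a : R, (e ^ n) a = a) {ϖ : R} (hϖ : Irreducible ϖ) (hϖe : e ϖ = ϖ)
    {R₀ : Type*} [CommRing R₀] [Algebra R₀ R]
    (hfix : ∀ x : R, e x = x → x ∈ Set.range (algebraMap R₀ R)) (x : R) (j : ℕ)
    (hx : e x - x ∈ IsLocalRing.maximalIdeal R ^ j) :
    ∃ x₀ : R₀, x - algebraMap R₀ R x₀ ∈ IsLocalRing.maximalIdeal R ^ j := by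
  have hϖ0 : ϖ ≠ 0 := hϖ.ne_zero
  have hpowfix : e (ϖ ^ j) = ϖ ^ j := by rw [map_pow, hϖe]
  rw [hϖ.maximalIdeal_eq, Ideal.span_singleton_pow] at hx ⊢
  rw [Ideal.mem_span_singleton] at hx
  obtain ⟨y, hy⟩ := hx
  have hsum : ∑ i ∈ Finset.range n, (e ^ i) y = 0 := by
    have h1 : ∑ i ∈ Finset.range n, (e ^ i) (e x - x) = 0 := by
      rw [sum_range_pow_apply_sub R e x n, hn x, sub_self]
    rw [hy, sum_range_pow_apply_mul_of_apply_eq R e hpowfix n y] at h1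
    exact (mul_eq_zero.mp h1).resolve_left (pow_ne_zero j hϖ0)
  obtain ⟨b, hb⟩ := exists_apply_sub_eq_of_sum_pow_eq_zero R e hcard hfrob hn hϖ hϖe y hsum
  have hfixed : e (x - ϖ ^ j * b) = x - ϖ ^ j * b := by
    rw [map_sub, map_mul, hpowfix]
    linear_combination hy - ϖ ^ j * hb
  obtain ⟨x₀, hx₀⟩ := hfix _ hfixed
  exact ⟨x₀, Ideal.mem_span_singleton.mpr ⟨b, by rw [hx₀]; ring⟩⟩

end Ring

/-! ### §3 The S15 layer: the restriction of the Frobenius generator to `R` -/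

section Layer

variable {F : Type u} [Field F] (L : Type u) [Field L] [Algebra F L]
  (R₀ : Type*) [CommRing R₀] [IsDomain R₀] [IsDiscreteValuationRing R₀] [Algebra R₀ F]
  [IsFractionRing R₀ F]
  (R : Type*) [CommRing R] [IsDomain R] [IsDiscreteValuationRing R] [Algebra R L]
  [IsFractionRing R L]
  [Algebra R₀ R] [Algebra R₀ L] [IsScalarTower R₀ R L] [IsScalarTower R₀ F L]

omit [IsDomain R₀] [IsDiscreteValuationRing R₀] [IsFractionRing R₀ F] [IsDomain R]
  [IsDiscreteValuationRing R] in
/-- **Restriction of an `F`-automorphism to `R`.** If every `τ ∈ Aut(L/F)` maps `R` into itself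
(binder R1), each `σ` restricts to a ring automorphism `e` of `R` (`σ⁻¹` also preserves `R`), and
`e` fixes `ι R₀` pointwise. [folklore] -/
theorem exists_ringEquiv_algebraMap_eq
    (hR : ∀ (τ : L ≃ₐ[F] L) (x : L), x ∈ Set.range (algebraMap R L) →
      τ x ∈ Set.range (algebraMap R L)) (σ : L ≃ₐ[F] L) :
    ∃ e : R ≃+* R, (∀ a : R, algebraMap R L (e a) = σ (algebraMap R L a)) ∧
      ∀ a₀ : R₀, e (algebraMap R₀ R a₀) = algebraMap R₀ R a₀ := by
  have hinj : Function.Injective (algebraMap R L) := IsFractionRing.injective R L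
  have hex : ∀ a : R, ∃ a' : R, algebraMap R L a' = σ (algebraMap R L a) := fun a ↦ by
    obtain ⟨a', ha'⟩ := hR σ (algebraMap R L a) ⟨a, rfl⟩; exact ⟨a', ha'⟩
  have hex' : ∀ a : R, ∃ a' : R, algebraMap R L a' = σ.symm (algebraMap R L a) := fun a ↦ by
    obtain ⟨a', ha'⟩ := hR σ.symm (algebraMap R L a) ⟨a, rfl⟩; exact ⟨a', ha'⟩
  choose f hf using hex
  choose g hg using hex'
  let e : R ≃+* R :=
    { toFun := f
      invFun := g
      left_inv := fun a ↦ hinj (by rw [hg, hf, AlgEquiv.symm_apply_apply])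
      right_inv := fun a ↦ hinj (by rw [hf, hg, AlgEquiv.apply_symm_apply])
      map_mul' := fun a b ↦ hinj (by simp only [hf, map_mul])
      map_add' := fun a b ↦ hinj (by simp only [hf, map_add]) }
  refine ⟨e, hf, fun a₀ ↦ hinj ?_⟩
  change algebraMap R L (f _) = _
  rw [hf, ← IsScalarTower.algebraMap_apply, IsScalarTower.algebraMap_apply R₀ F L, AlgEquiv.commutes]

/-- **The restriction `e` of the Frobenius generator `φ` to `R` and its properties.** In the S15
layer (R1 `hR`, R4 `hφ`/`hn`/`hfrob`, R5 `hπ`, R6 `[IsGalois F L]`, `R₀ → R` local): there is a ring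
automorphism `e` of `R` with `ι ∘ e = φ ∘ ι`, fixing `ι R₀`, inducing `x ↦ x^q` on the residue
field, with `eⁿ = 1`, fixing the uniformiser `ϖ`, and whose fixed points come from `R₀` (a
`φ`-fixed element is fixed by `Aut(L/F) = ⟨φ⟩`, hence lies in `F` — Mathlib
`InfiniteGalois.mem_range_algebraMap_iff_fixed` — and in `R ∩ F = R₀`, part 1
`algebraMap_mem_range_iff`). [folklore] -/
theorem exists_ringEquiv_frobenius [IsGalois F L] [IsLocalHom (algebraMap R₀ R)]
    (hR : ∀ (τ : L ≃ₐ[F] L) (x : L), x ∈ Set.range (algebraMap R L) →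
      τ x ∈ Set.range (algebraMap R L))
    (φ : L ≃ₐ[F] L) (hφ : ∀ σ : L ≃ₐ[F] L, σ ∈ Subgroup.zpowers φ) {q n : ℕ} (hn : φ ^ n = 1)
    (hfrob : ∀ a : R, ∃ a' : R, algebraMap R L a' = φ (algebraMap R L a) ∧
      IsLocalRing.residue R a' = IsLocalRing.residue R a ^ q)
    {ϖ : R} {π : F} (hπ : algebraMap F L π = algebraMap R L ϖ) :
    ∃ e : R ≃+* R, (∀ a : R, algebraMap R L (e a) = φ (algebraMap R L a)) ∧
      (∀ a₀ : R₀, e (algebraMap R₀ R a₀) = algebraMap R₀ R a₀) ∧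
      (∀ a : R, IsLocalRing.residue R (e a) = IsLocalRing.residue R a ^ q) ∧
      (∀ a : R, (e ^ n) a = a) ∧ e ϖ = ϖ ∧
      ∀ x : R, e x = x → x ∈ Set.range (algebraMap R₀ R) := by
  have hinj : Function.Injective (algebraMap R L) := IsFractionRing.injective R L
  obtain ⟨e, he, he₀⟩ := exists_ringEquiv_algebraMap_eq L R₀ R hR φ
  have hpow : ∀ (i : ℕ) (a : R), algebraMap R L ((e ^ i) a) = (φ ^ i) (algebraMap R L a) := by
    intro i
    induction i with
    | zero => intro a; simp
    | succ i ih =>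
      intro a
      rw [pow_succ, RingAut.mul_apply, pow_succ, AlgEquiv.mul_apply, ← he, ih]
  refine ⟨e, he, he₀, fun a ↦ ?_, fun a ↦ hinj ?_, hinj ?_, fun x hx ↦ ?_⟩
  · obtain ⟨a', ha', hres⟩ := hfrob a
    rw [show e a = a' from hinj (by rw [he, ha']), hres]
  · rw [hpow, hn, AlgEquiv.one_apply]
  · rw [he, ← hπ, AlgEquiv.commutes]
  · -- `ι x` is fixed by `φ`, hence by every `σ ∈ ⟨φ⟩ = Aut(L/F)`, hence lies in `F`
    have hφx : φ (algebraMap R L x) = algebraMap R L x := by rw [← he, hx]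
    have hall : ∀ σ : L ≃ₐ[F] L, σ (algebraMap R L x) = algebraMap R L x := by
      intro σ
      have hmem : σ ∈ MulAction.stabilizer (L ≃ₐ[F] L) (algebraMap R L x) :=
        (Subgroup.zpowers_le.mpr (by simpa [MulAction.mem_stabilizer_iff] using hφx)) (hφ σ)
      simpa [MulAction.mem_stabilizer_iff] using hmem
    obtain ⟨f, hf⟩ := (InfiniteGalois.mem_range_algebraMap_iff_fixed (algebraMap R L x)).mpr hall
    obtain ⟨x₀, hx₀⟩ := (algebraMap_mem_range_iff L R₀ R f).mp ⟨x, hf.symm⟩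
    refine ⟨x₀, hinj ?_⟩
    rw [← IsScalarTower.algebraMap_apply, IsScalarTower.algebraMap_apply R₀ F L, hx₀, hf]

/-- **S15 (viii) export: Galois descent modulo every `𝔪ʲ` along the complete unramified layer.**
In the S15 layer (R1–R6: `hR`, `[IsAdicComplete 𝔪 R]`, `[Finite k]` + `hcard`, `φ`/`hφ`/`hn`/
`hfrob`, `hϖ`/`hπ`, `[IsGalois F L]`; `R₀ → R` local) the Frobenius generator restricts to a ring
automorphism `e` of `R` with `ι ∘ e = φ ∘ ι`, fixing `ι R₀`, and such that for every `j` and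
every `x ∈ R` with `e x − x ∈ 𝔪ʲ` there is `x₀ ∈ R₀` with `x − ι x₀ ∈ 𝔪ʲ`
(`(R/𝔪ʲ)^{Aut(L/F)} = R₀/𝔪₀ʲ`). [cite: SerreLocalFields1979, X §1 Prop. 1, VII §1] -/
theorem exists_ringEquiv_frobenius_descent [IsGalois F L] [IsLocalHom (algebraMap R₀ R)]
    [IsAdicComplete (IsLocalRing.maximalIdeal R) R] [Finite (IsLocalRing.ResidueField R)]
    (hR : ∀ (τ : L ≃ₐ[F] L) (x : L), x ∈ Set.range (algebraMap R L) →
      τ x ∈ Set.range (algebraMap R L))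
    (φ : L ≃ₐ[F] L) (hφ : ∀ σ : L ≃ₐ[F] L, σ ∈ Subgroup.zpowers φ) {q n : ℕ} (hn : φ ^ n = 1)
    (hcard : Nat.card (IsLocalRing.ResidueField R) = q ^ n)
    (hfrob : ∀ a : R, ∃ a' : R, algebraMap R L a' = φ (algebraMap R L a) ∧
      IsLocalRing.residue R a' = IsLocalRing.residue R a ^ q)
    {ϖ : R} (hϖ : Irreducible ϖ) {π : F} (hπ : algebraMap F L π = algebraMap R L ϖ) :
    ∃ e : R ≃+* R, (∀ a : R, algebraMap R L (e a) = φ (algebraMap R L a)) ∧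
      (∀ a₀ : R₀, e (algebraMap R₀ R a₀) = algebraMap R₀ R a₀) ∧
      ∀ (j : ℕ) (x : R), e x - x ∈ IsLocalRing.maximalIdeal R ^ j →
        ∃ x₀ : R₀, x - algebraMap R₀ R x₀ ∈ IsLocalRing.maximalIdeal R ^ j := by
  obtain ⟨e, he, he₀, hres, hen, hϖe, hfix⟩ :=
    exists_ringEquiv_frobenius L R₀ R hR φ hφ hn hfrob hπ
  exact ⟨e, he, he₀, fun j x hx ↦
    exists_sub_algebraMap_mem_pow_of_apply_sub_mem_pow R e hcard hres hen hϖ hϖe hfix x j hx⟩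

end Layer

end Summit.BirchSwinnertonDyer.Rank1Residual.X11b.Three.JetchevKummer

end
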